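import Literature.AlgebraicGeometry.Motives.TateConjectureStrongFormFrobeniusPolynomial
import Literature.AlgebraicGeometry.Kahn2003.RationalNumericalEquivalenceOfTate
import Literature.NumberTheory.LFunctions.WeilConjecturesFactorizationProofs
import HarnessLib

/-!
# The order of the pole of `Z(X, t)` at `t = q^{-r}` and Tate's theorem (Tate 1994 Th. 2.9 (c);
# Kahn 2020 Conj. 6.52 / Th. 6.53; Milne 2007 Th. 1.2)

Topic `Literature/AlgebraicGeometry/Motives`; THEOREMS ONLY (no definition, no named fact).

Rows g37-#2/#3 (`TateConjectureStrongFormFiniteField`, `…FrobeniusPolynomial`) proved Tate's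
theorem for the tree's Galois Weil cohomology `E` over a finite field `k` with the "pole side"
expressed as the multiplicity `mult_{c^r} P_{2r}(X, t)` of `c^r`, `c = χ(F)`, as a root of
`P_{2r}(X, t) = det(1 - tF | H^{2r}(X))`. This file identifies that multiplicity with **the order
of the pole of the zeta function `Z(X, t)` at `t = q^{-r}`** in the tree's sense
`Kahn2003.HasPoleOfOrderAt` (`Z · B · (T - t₀)^ρ = A` with `A(t₀) B(t₀) ≠ 0`), under the hypotheses
that make `Z(X, t) = ∏ P_i^{(-1)^{i+1}}` available and pin the pole to `P_{2r}`:
the Lefschetz trace formula `E.HasLefschetzTraceFormula` (Grothendieck), the normalisation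
`χ(φ) = q` of the character on the arithmetic Frobenius (so `c = χ(F) = q⁻¹` on the geometric one)
and the Riemann hypothesis `E.WeilRiemannHypothesisFor X d` (Deligne 1974 Th. (1.6): integral
models `P_i ∈ ℤ[t]` whose complex roots have absolute value `q^{-i/2}`, so that `P_i(q^{-r}) ≠ 0`
for `i ≠ 2r`).

* §1 (pure, any Weil factorisation `IsWeilFactorization q n Z P`, `1 < q`):
  `P_i(q^{-r}) ≠ 0` for `i ≠ 2r` (`eval_ne_zero_of_ne`) and **`Z` has a pole of order exactly
  `mult_{q^{-r}} P_{2r}` at `t = q^{-r}`** (`hasPoleOfOrderAt`), `r ≤ n`.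
* §2 (`E`, `k` finite): `χ(F) = q⁻¹` (`coe_χ_geomFrob`); root multiplicities of an integral model
  agree with those of `E.frobCharPoly` (`rootMultiplicity_map_eq_rootMultiplicity_frobCharPoly`);
  **`ord_{t = q^{-r}} Z(X, t) = dim_K H^{2r}(X)(r)_1`** (`hasPoleOfOrderAt_zetaSeries`); and the
  literal forms of **Tate 1994 Th. 2.9 / Milne 2007 Th. 1.2** — «the order of the pole of
  `Z(X, t)` at `t = q^{-r}` is equal to the rank of the group of numerical equivalence classes of
  algebraic cycles of codimension `r`» iff `T^r ∧ E^r` iff `T^r ∧ T^{d-r} ∧ S^r`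
  (`hasPoleOfOrderAt_zetaSeries_rank_iff`, `…_iff'` = **Kahn 2020 Th. 6.53** for Conj. 6.52
  «`ord_{s=i} ζ(X, s) = -rg A^i_num(X)`»), and of **Milne 1986 `T(X, r, ℓ)` / Prop. 8.2** with the
  pole order (`hasPoleOfOrderAt_zetaSeries_finrank_algebraicClasses_iff`); the unconditional
  inequality `ρ_r ≤ ord` (`rank_le_poleOrder`).

The rank `ρ_r` is, as in rows #1–#3, the rank of the Poincaré pairing on `K·Aʳ(X) × K·Aˢ(X)`
(`r + s = d`), the `K`-dimension of the codimension-`r` algebraic classes modulo numerical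
equivalence computed in `E`.

Sources (read on the page): B. Kahn, *Zeta and L-functions of varieties and motives* (2020)
§6.14 p. 132, Conj. 6.52 and Th. 6.53; J. S. Milne, arXiv:0709.3040 Th. 1.2 (p. 4) and
arXiv:1210.7460 §0.4 (`T^r(X)`: «The order of the pole of the zeta function `Z(X, t)` at
`t = q^{-r}` is equal to `ρ_r`»; «`T^r(X)` is implied by the conjunction of `T^r(X,l)`,
`T^{d-r}(X,l)`, and `S^r(X,l)` for a single `l`, and implies `T^r(X,l)`, `T^{d-r}(X,l)`,
`S^r(X,l)`, `S^{d-r}(X,l)`»); J. S. Milne, Amer. J. Math. 108 (1986) §8 Prop. 8.2; J. Tate, PSPM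
55.1 (1994) Th. 2.9 (second-hand); P. Deligne, *Weil I* (1974) (1.5.4), Th. (1.6). The tree inputs:
`zetaSeries_mul_prod_frobCharPoly_holds` (`FrobeniusTraceProofs`),
`isWeilFactorization_of_isIntegralModel` (`NumberTheory/LFunctions/WeilConjecturesFactorizationProofs`),
`Kahn2003.HasPoleOfOrderAt` and its uniqueness (`AlgebraicGeometry/Kahn2003/RationalNumericalEquivalenceOfTate`).

## Provenance

Lane `lit-hodgefound` (summit `HodgeConjecture`, Track 2 foundations library, Layer B: motives),
seat `lit-hodgefound-p29` (literature-prover, generation 37, row g37-#4).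
-/

universe u v

open CategoryTheory AlgebraicGeometry Polynomial

noncomputable section

namespace Literature.AlgebraicGeometry.Motives

open Literature.LinearAlgebra Literature.AlgebraicGeometry.Kahn2003
open Literature.NumberTheory.LFunctions

/-! ## §1 The pole of a Weil factorisation at `t = q^{-r}` -/

namespace IsWeilFactorization

variable {q n : ℕ} {Z : PowerSeries ℚ} {P : Fin (2 * n + 1) → ℤ[X]}

/-- **`P_i(q^{-r}) ≠ 0` for `i ≠ 2r`**: the complex roots of `P_i` have absolute value `q^{-i/2}`,
and `|q^{-r}| = q^{-i/2}` forces `i = 2r` (`q > 1`). [cite: Deligne1974, Thm. (1.6)]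
[cite: Kahn2020, §6.14 Conj. 6.52 (the case i = 0 «due to the Riemann hypothesis»)] -/
theorem eval_ne_zero_of_ne (hq : 1 < q) (hW : IsWeilFactorization q n Z P) {r : ℕ}
    (i : Fin (2 * n + 1)) (hi : (i : ℕ) ≠ 2 * r) :
    ((P i).map (Int.castRingHom ℚ)).eval (((q : ℚ) ^ r)⁻¹) ≠ 0 := by
  intro h0
  set t₀ : ℚ := ((q : ℚ) ^ r)⁻¹ with ht₀
  -- `t₀` is a complex root of `P_i`
  have hroot : ((P i).map (Int.castRingHom ℂ)).IsRoot (algebraMap ℚ ℂ t₀) := by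
    have hcomp : (algebraMap ℚ ℂ).comp (Int.castRingHom ℚ) = Int.castRingHom ℂ :=
      RingHom.ext_int _ _
    rw [IsRoot.def, ← hcomp, ← Polynomial.map_map, eval_map, eval₂_hom, h0, map_zero]
  have hnorm := hW.2.2.2.2 i _ hroot
  -- `‖t₀‖ = q^{-r}`
  have hq0 : (0 : ℝ) < q := by exact_mod_cast (zero_lt_one.trans hq)
  have hq1 : (1 : ℝ) < q := by exact_mod_cast hq
  have ht₀C : ‖(algebraMap ℚ ℂ t₀)‖ = (q : ℝ) ^ (-(r : ℝ)) := by
    rw [ht₀, map_inv₀, map_pow, map_natCast, norm_inv, norm_pow, Complex.norm_natCast,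
      Real.rpow_neg hq0.le, Real.rpow_natCast]
  rw [ht₀C] at hnorm
  -- compare exponents
  have hexp : (-(r : ℝ)) = -((i : ℕ) : ℝ) / 2 := by
    refine le_antisymm ?_ ?_
    · exact (Real.rpow_le_rpow_left_iff hq1).mp hnorm.le
    · exact (Real.rpow_le_rpow_left_iff hq1).mp hnorm.ge
  have : ((i : ℕ) : ℝ) = 2 * r := by linarith
  exact hi (by exact_mod_cast this)

/-- **The order of the pole of `Z` at `t = q^{-r}` is the multiplicity of `q^{-r}` as a root of
`P_{2r}`** (`r ≤ n`, `1 < q`): from `Z · ∏_{even} P_i = ∏_{odd} P_i` and `P_i(q^{-r}) ≠ 0` for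
`i ≠ 2r`, writing `P_{2r} = (t - q^{-r})^ρ R` with `R(q^{-r}) ≠ 0`. [cite: Deligne1974, (1.5.4) and Thm. (1.6)]
[cite: Milne2012AddendumZetaValues, §0.4 T^r(X)] [cite: Kahn2020, §6.14 Conj. 6.52] -/
theorem hasPoleOfOrderAt (hq : 1 < q) (hW : IsWeilFactorization q n Z P) {r : ℕ} (hr : r ≤ n) :
    HasPoleOfOrderAt Z (((q : ℚ) ^ r)⁻¹)
      (((P ⟨2 * r, by omega⟩).map (Int.castRingHom ℚ)).rootMultiplicity (((q : ℚ) ^ r)⁻¹)) := by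
  classical
  set t₀ : ℚ := ((q : ℚ) ^ r)⁻¹ with ht₀
  set i₀ : Fin (2 * n + 1) := ⟨2 * r, by omega⟩ with hi₀
  set Q : Fin (2 * n + 1) → ℚ[X] := fun i ↦ (P i).map (Int.castRingHom ℚ) with hQ
  -- `Q i₀ ≠ 0` (its constant coefficient is `1`)
  have hQ0 : Q i₀ ≠ 0 := by
    intro h
    have h1 : (Q i₀).coeff 0 = 1 := by
      simp only [hQ, Polynomial.coeff_map, hW.1 i₀, eq_intCast, Int.cast_one]
    rw [h, coeff_zero] at h1
    exact zero_ne_one h1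
  -- `Q i₀ = (X - C t₀)^ρ * R`, `R(t₀) ≠ 0`
  set ρ := (Q i₀).rootMultiplicity t₀ with hρ
  set R := Q i₀ /ₘ (X - C t₀) ^ ρ with hR
  have hdec : (X - C t₀) ^ ρ * R = Q i₀ := (Q i₀).pow_mul_divByMonic_rootMultiplicity_eq t₀
  have hRt : R.eval t₀ ≠ 0 := eval_divByMonic_pow_rootMultiplicity_ne_zero t₀ hQ0
  -- the even and odd index sets
  set Se := (Finset.univ : Finset (Fin (2 * n + 1))).filter (fun i ↦ Even i.val) with hSe
  set So := (Finset.univ : Finset (Fin (2 * n + 1))).filter (fun i ↦ Odd i.val) with hSo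
  have hi₀Se : i₀ ∈ Se := by
    simp only [hSe, Finset.mem_filter, Finset.mem_univ, true_and, hi₀]
    exact even_two_mul r
  -- non-vanishing of the other factors at `t₀`
  have hne : ∀ i : Fin (2 * n + 1), i ≠ i₀ → (Q i).eval t₀ ≠ 0 := by
    intro i hi
    refine hW.eval_ne_zero_of_ne hq i ?_
    intro h
    exact hi (Fin.ext (by rw [h, hi₀]))
  set Be := ∏ i ∈ Se.erase i₀, Q i with hBe
  set A := ∏ i ∈ So, Q i with hA
  refine ⟨A, R * Be, ?_, ?_, ?_⟩
  · -- `A(t₀) ≠ 0`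
    rw [hA, eval_prod]
    refine Finset.prod_ne_zero_iff.mpr fun i hi ↦ hne i ?_
    intro h
    have hodd : Odd (2 * r) := by simpa [hSo, h, hi₀] using hi
    obtain ⟨m, hm⟩ := hodd
    omega
  · -- `(R · Be)(t₀) ≠ 0`
    rw [eval_mul, hBe, eval_prod]
    refine mul_ne_zero hRt (Finset.prod_ne_zero_iff.mpr fun i hi ↦ hne i ?_)
    exact (Finset.mem_erase.mp hi).1
  · -- `Z · (R Be (X - t₀)^ρ) = A`
    have hprod : R * Be * (X - C t₀) ^ ρ = ∏ i ∈ Se, Q i := by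
      rw [← Finset.mul_prod_erase Se Q hi₀Se, ← hdec]
      ring
    have hcoe : ∀ s : Finset (Fin (2 * n + 1)),
        ((∏ i ∈ s, Q i : ℚ[X]) : PowerSeries ℚ) = ∏ i ∈ s, (Q i : PowerSeries ℚ) := fun s ↦ by
      rw [← coeToPowerSeries.ringHom_apply, map_prod]
      simp only [coeToPowerSeries.ringHom_apply]
    rw [hprod, hA, hcoe, hcoe]
    exact hW.2.1

end IsWeilFactorization

/-! ## §2 The pole of `Z(X, t)` at `t = q^{-r}` and Tate's theorem for `E` -/

namespace GaloisWeilCohomology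

variable {k : Type u} [Field k] [Finite k] {K : Type v} [Field K] [CharZero K]
  {χ : Field.absoluteGaloisGroup k →* Kˣ} (E : GaloisWeilCohomology k K χ)
variable {d : ℕ} {X : SchemeOver k}

omit [CharZero K] in
/-- **`χ(F) = q⁻¹` on the geometric Frobenius** when `χ(φ) = q` on the arithmetic one
(`F = φ⁻¹`; the normalisation of the cyclotomic character). [cite: Deligne1974, (1.15)]
[cite: Tate1994, §1] -/
theorem coe_χ_geomFrob (hχ : ((χ (arithFrob k) : Kˣ) : K) = Nat.card k) :
    ((χ (geomFrob k) : Kˣ) : K) = (Nat.card k : K)⁻¹ := by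
  rw [show geomFrob k = (arithFrob k)⁻¹ from rfl, map_inv, Units.val_inv_eq_inv_val, hχ]

/-- **Root multiplicities of an integral model are those of `P_i(X, t) = det(1 - tF | Hⁱ(X))`**:
for `P ∈ ℤ[t]` with `P ↦ E.frobCharPoly X i` and `t ∈ ℚ`,
`mult_t (P ⊗ ℚ) = mult_t (E.frobCharPoly X i)` (root multiplicity is preserved by the field
extension `ℚ → K`, Mathlib `Polynomial.eq_rootMultiplicity_map`). [cite: Deligne1974, Thm. (1.6)] -/
theorem rootMultiplicity_map_eq_rootMultiplicity_frobCharPoly (X : SchemeOver k) {i : ℕ}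
    {P : ℤ[X]} (hP : E.IsIntegralModel X i P) (t : ℚ) :
    (P.map (Int.castRingHom ℚ)).rootMultiplicity t = (E.frobCharPoly X i).rootMultiplicity (t : K) := by
  have hcomp : (algebraMap ℚ K).comp (Int.castRingHom ℚ) = Int.castRingHom K := RingHom.ext_int _ _
  rw [eq_rootMultiplicity_map (algebraMap ℚ K).injective t, Polynomial.map_map, hcomp,
    show (P.map (Int.castRingHom K)) = E.frobCharPoly X i from hP, eq_ratCast]

/-- **`ord_{t = q^{-r}} Z(X, t) = dim_K H^{2r}(X)(r)_1`**: under the trace formula, `χ(φ) = q` and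
the Riemann hypothesis for `X` (smooth projective of dimension `d`, `r ≤ d`), the zeta function
`Z(X, t)` has a pole at `t = q^{-r}` of order exactly the dimension of the generalized eigenspace of
`q^r` of Frobenius on `H^{2r}(X)` (= the multiplicity of `q^r` as an inverse root of `P_{2r}(X, t)`).
[cite: Deligne1974, (1.5.4) and Thm. (1.6)] [cite: Milne2012AddendumZetaValues, §0.4]
[cite: Kahn2020, §6.14 Conj. 6.52 and Th. 6.53] -/
theorem hasPoleOfOrderAt_zetaSeries (hE : E.HasLefschetzTraceFormula)
    (hχ : ((χ (arithFrob k) : Kˣ) : K) = Nat.card k) (hX : IsSmoothProjective d X)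
    (hRH : E.WeilRiemannHypothesisFor X d) {r : ℕ} (hr : r ≤ d) :
    HasPoleOfOrderAt (zetaSeries X) (((Nat.card k : ℚ) ^ r)⁻¹)
      (Module.finrank K (Module.End.maxGenEigenspace (E.ρTwist X (2 * r) r (geomFrob k)) 1)) := by
  obtain ⟨P, hP, hroots⟩ := hRH
  have hW := isWeilFactorization_of_isIntegralModel E hE hχ hX hP hroots
  have hq : 1 < Nat.card k := Finite.one_lt_card
  have hpole := hW.hasPoleOfOrderAt hq hr
  have hmult : ((P ⟨2 * r, by omega⟩).map (Int.castRingHom ℚ)).rootMultiplicity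
      (((Nat.card k : ℚ) ^ r)⁻¹) =
      Module.finrank K (Module.End.maxGenEigenspace (E.ρTwist X (2 * r) r (geomFrob k)) 1) := by
    rw [E.rootMultiplicity_map_eq_rootMultiplicity_frobCharPoly X (hP ⟨2 * r, by omega⟩),
      E.finrank_maxGenEigenspace_ρTwist_eq_rootMultiplicity hX (2 * r) r, coe_χ_geomFrob hχ,
      inv_pow]
    push_cast
    rfl
  rwa [hmult] at hpole

/-- **The rank of the numerical classes is at most the order of the pole** (the proved half of
Kahn's Conj. 6.52 «`ord_{s=i} ζ(X, s) = -rg A^i_num(X)`»): under the trace formula, `χ(φ) = q` and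
RH, `Z(X, t)` has at `t = q^{-r}` a pole of some order `ρ ≥ ρ_r`, `ρ_r` the rank of the Poincaré
pairing on `K·Aʳ(X) × K·Aˢ(X)`. [cite: Kahn2020, §6.14 Conj. 6.52 and Th. 6.53] [cite: Tate1994, §2 Th. 2.9] -/
theorem rank_le_poleOrder (hE : E.HasLefschetzTraceFormula)
    (hχ : ((χ (arithFrob k) : Kˣ) : K) = Nat.card k) (hX : IsSmoothProjective d X)
    (hRH : E.WeilRiemannHypothesisFor X d) {r s : ℕ} (hrs : r + s = d) (h : 2 * r + 2 * s = 2 * d) :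
    ∃ ρ : ℕ, HasPoleOfOrderAt (zetaSeries X) (((Nat.card k : ℚ) ^ r)⁻¹) ρ ∧
      Module.finrank K (LinearMap.range ((E.cupPairing X d (2 * r) (2 * s) h).domRestrict₁₂
        (E.algebraicClasses X r) (E.algebraicClasses X s))) ≤ ρ :=
  ⟨_, E.hasPoleOfOrderAt_zetaSeries hE hχ hX hRH (by omega), E.rank_le_finrank_maxGenEigenspace hX h⟩

/-- **Tate 1994 Th. 2.9 `(c) ⟺ (a)` / Milne 2007 Th. 1.2, verbatim pole form**: under the trace
formula, `χ(φ) = q` and RH, «the order of the pole of the zeta function `Z(X, t)` at `t = q^{-r}` is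
equal to the rank of the group of numerical equivalence classes of algebraic cycles of codimension
`r`» (`HasPoleOfOrderAt (zetaSeries X) q^{-r} ρ_r`) **iff** `T^r ∧ E^r` (Frobenius form:
`K·Aʳ(X) = Ker(φ_r - 1)` and the Poincaré pairing on `Aʳ(X)_ℚ × Aˢ(X)_ℚ` has trivial left kernel).
[cite: Tate1994, §2 Th. 2.9] [cite: Milne2007TateFiniteFieldsAIM, Th. 1.2]
[cite: Milne2012AddendumZetaValues, §0.4] -/
theorem hasPoleOfOrderAt_zetaSeries_rank_iff (hE : E.HasLefschetzTraceFormula)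
    (hχ : ((χ (arithFrob k) : Kˣ) : K) = Nat.card k) (hX : IsSmoothProjective d X)
    (hRH : E.WeilRiemannHypothesisFor X d) {r s : ℕ} (hrs : r + s = d) (h : 2 * r + 2 * s = 2 * d) :
    HasPoleOfOrderAt (zetaSeries X) (((Nat.card k : ℚ) ^ r)⁻¹)
        (Module.finrank K (LinearMap.range ((E.cupPairing X d (2 * r) (2 * s) h).domRestrict₁₂
          (E.algebraicClasses X r) (E.algebraicClasses X s)))) ↔
      (E.algebraicClasses X r = LinearMap.ker (E.ρTwist X (2 * r) r (geomFrob k) - 1) ∧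
        ∀ x ∈ E.ratAlgebraicClasses X r, (∀ y ∈ E.ratAlgebraicClasses X s,
          E.cupPairing X d (2 * r) (2 * s) h x y = 0) → x = 0) := by
  have hpole := E.hasPoleOfOrderAt_zetaSeries hE hχ hX hRH (show r ≤ d by omega)
  rw [← E.rank_eq_finrank_maxGenEigenspace_iff hX hrs h]
  constructor
  · intro hc
    exact hc.unique hpole
  · intro hc
    rwa [hc]

/-- **Kahn 2020 Th. 6.53 verbatim — Conj. 6.52 («`ord_{s=r} ζ(X, s) = -rg A^r_num(X)`») for `(X, r)`
is equivalent to `T^r + T^{d-r} + S^r`** (under the trace formula, `χ(φ) = q` and RH, which turn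
the pole order into `dim H^{2r}(X)(r)_1`). [cite: Kahn2020, §6.14 Th. 6.53] [cite: Tate1994, §2 Th. 2.9]
[cite: Milne2012AddendumZetaValues, §0.4] -/
theorem hasPoleOfOrderAt_zetaSeries_rank_iff' (hE : E.HasLefschetzTraceFormula)
    (hχ : ((χ (arithFrob k) : Kˣ) : K) = Nat.card k) (hX : IsSmoothProjective d X)
    (hRH : E.WeilRiemannHypothesisFor X d) {r s : ℕ} (hrs : r + s = d) (h : 2 * r + 2 * s = 2 * d) :
    HasPoleOfOrderAt (zetaSeries X) (((Nat.card k : ℚ) ^ r)⁻¹)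
        (Module.finrank K (LinearMap.range ((E.cupPairing X d (2 * r) (2 * s) h).domRestrict₁₂
          (E.algebraicClasses X r) (E.algebraicClasses X s)))) ↔
      (E.algebraicClasses X r = LinearMap.ker (E.ρTwist X (2 * r) r (geomFrob k) - 1) ∧
        E.algebraicClasses X s = LinearMap.ker (E.ρTwist X (2 * s) s (geomFrob k) - 1) ∧
        LinearMap.ker (E.ρTwist X (2 * r) r (geomFrob k) - 1) ⊓
          LinearMap.range (E.ρTwist X (2 * r) r (geomFrob k) - 1) = ⊥) := by
  rw [E.hasPoleOfOrderAt_zetaSeries_rank_iff hE hχ hX hRH hrs h, E.tate_a_iff_b hX hrs h]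

/-- **Milne 1986 Prop. 8.2 with the pole order — `T(X, r) ⟺ T′(X, r) ∧ SS(X, r)`**: under the
trace formula, `χ(φ) = q` and RH, `Z(X, t)` has at `t = q^{-r}` a pole of order exactly
`dim K·Aʳ(X)` iff `K·Aʳ(X) = Ker(φ_r - 1)` and `1` is a semisimple eigenvalue of `φ_r`.
[cite: Milne1986ValuesZetaFunctionsFiniteFields, §8 Prop. 8.2] [cite: Tate1994, §2 Th. 2.9] -/
theorem hasPoleOfOrderAt_zetaSeries_finrank_algebraicClasses_iff (hE : E.HasLefschetzTraceFormula)
    (hχ : ((χ (arithFrob k) : Kˣ) : K) = Nat.card k) (hX : IsSmoothProjective d X)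
    (hRH : E.WeilRiemannHypothesisFor X d) {r : ℕ} (hr : r ≤ d) :
    HasPoleOfOrderAt (zetaSeries X) (((Nat.card k : ℚ) ^ r)⁻¹)
        (Module.finrank K (E.algebraicClasses X r)) ↔
      E.algebraicClasses X r = LinearMap.ker (E.ρTwist X (2 * r) r (geomFrob k) - 1) ∧
        LinearMap.ker (E.ρTwist X (2 * r) r (geomFrob k) - 1) ⊓
          LinearMap.range (E.ρTwist X (2 * r) r (geomFrob k) - 1) = ⊥ := by
  have hpole := E.hasPoleOfOrderAt_zetaSeries hE hχ hX hRH hr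
  rw [← E.finrank_algebraicClasses_eq_iff hX r]
  constructor
  · intro hc
    exact hc.unique hpole
  · intro hc
    rwa [hc]

/-- **The consequences of the pole statement** («… and implies `T^r(X,l)`, `T^{d-r}(X,l)`,
`S^r(X,l)`, `S^{d-r}(X,l)`»; «this implies hom = num in codimensions `i` and `d-i`»): if `Z(X, t)`
has at `t = q^{-r}` a pole of order exactly `ρ_r`, then the tree's `E.TateConjectureFor X r` and
`E.TateConjectureFor X s` hold, `S(r)` and `S(s)` hold, and numerically trivial cycles of
codimension `r` and `s` are homologically trivial. [cite: Milne2012AddendumZetaValues, §0.4]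
[cite: Kahn2020, §6.14 Th. 6.53] [cite: Tate1994, §2 Th. 2.9] -/
theorem consequences_of_hasPoleOfOrderAt_zetaSeries (hE : E.HasLefschetzTraceFormula)
    (hχ : ((χ (arithFrob k) : Kˣ) : K) = Nat.card k) (hX : IsSmoothProjective d X)
    (hRH : E.WeilRiemannHypothesisFor X d) {r s : ℕ} (hrs : r + s = d) (h : 2 * r + 2 * s = 2 * d)
    (hc : HasPoleOfOrderAt (zetaSeries X) (((Nat.card k : ℚ) ^ r)⁻¹)
        (Module.finrank K (LinearMap.range ((E.cupPairing X d (2 * r) (2 * s) h).domRestrict₁₂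
          (E.algebraicClasses X r) (E.algebraicClasses X s))))) :
    E.TateConjectureFor X r ∧ E.TateConjectureFor X s ∧
      LinearMap.ker (E.ρTwist X (2 * r) r (geomFrob k) - 1) ⊓
          LinearMap.range (E.ρTwist X (2 * r) r (geomFrob k) - 1) = ⊥ ∧
      LinearMap.ker (E.ρTwist X (2 * s) s (geomFrob k) - 1) ⊓
          LinearMap.range (E.ρTwist X (2 * s) s (geomFrob k) - 1) = ⊥ ∧
      (∀ c : AlgebraicCycle X.left ℤ,
        E.IsNumericallyTrivial d X r c → E.IsHomologicallyTrivial X r c) ∧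
      ∀ c : AlgebraicCycle X.left ℤ,
        E.IsNumericallyTrivial d X s c → E.IsHomologicallyTrivial X s c := by
  obtain ⟨hT, hEr⟩ := (E.hasPoleOfOrderAt_zetaSeries_rank_iff hE hχ hX hRH hrs h).mp hc
  have h' : 2 * s + 2 * r = 2 * d := by omega
  obtain ⟨hTr, hTs, -, hSr, hSs⟩ := E.consequences_of_tate_a hX hrs h h' hT hEr
  have hrank := (E.rank_eq_finrank_maxGenEigenspace_iff hX hrs h).mpr ⟨hT, hEr⟩
  obtain ⟨hnr, hns⟩ := E.isHomologicallyTrivial_of_rank_eq hX hrs h hrank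
  exact ⟨hTr, hTs, hSr, hSs, hnr, hns⟩

end GaloisWeilCohomology

end Literature.AlgebraicGeometry.Motives

end
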